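import Mathlib
import HarnessLib
import Summits.HubbardSuperconductivity.HubbardSuperconductivity.Theorems.KLProgrammeC4aFoldSignedLaw

/-!
# Route `KLProgramme` — crux C4a, S3 brick (B4) «(B4)-UMK1», (N5)/(M3) the SIGNED FOLD LAW, SHARP FORM — CORE TOOLS: IBP with an integrable majorant of the remainder,
# the far-piece integrals, quadratic growth away from the fold point

Cell `gate-hubbard-kl`, seat hubbard-kl-k3c3-p3 (g28; row «implicit-function / monotonicity route for μ(n)»).  Located brick for the (C)-closer lane hubbard-kl-c4a-1
(stub (C) `stub_twoLeg_curvature` of `KLRegimeEngineV17F2`, stmt-HubbardSuperconductivity-20437), memo HOME/hubbard-kl-k3c3-p3/U1-CAUSTIC-SUP.md §4/§7 (M3).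
In `…C4aFoldSignedLaw.abs_intervalIntegral_mul_deriv_comp_le_fold` the term `X₀L₂/σ²·σ⁻¹·(2 + 4log⁺(G/t))` is `M^{−3/2}·log⁺(G/t)`: after the level integral the
`|δ₀|^{−1/2}` then carries `log(1/|δ₀|)`, which is NOT integrable uniformly across a weakly transversal pair of caustic zeros (memo §3).  The log is a sup × L¹ artefact:
far from the fold point the slope grows (`|g′(v)| ≥ c₂|v − v*|`) and the band is high (`g ≥ m + 2M ≥ M` beyond `x₁ = 2√(M/c₂)`), so the IBP remainder decays like
`1/|v − v*|²` there.  This file splits each outer branch at distance `x₁` from the fold point: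
This file (CORE, part 1 of 2): the three tools —
* §1 **`abs_intervalIntegral_mul_deriv_comp_le_ends_majorant`** — part 1's IBP window estimate with the remainder bounded by ANY integrable majorant of
  `|((X′g′ − Xg″)/g′²)·K(g)|` (the end terms as before);
* §2 `far_majorant_integral` — `∫_a^b (X₁/(c₂x) + X₀L₂/(c₂²x²))/M dx = (X₁/(c₂M))·log(b/a) + (X₀L₂/(c₂²M))·(a⁻¹ − b⁻¹)` (`0 < a ≤ b`);
* §3 `sub_ge_of_fold` — quadratic growth away from the fold point: `(c₂/2)(v − v*)² ≤ g v − g v*`.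
The assembly (`abs_intervalIntegral_mul_deriv_comp_le_fold_sharp`) is `…C4aFoldSignedLawSharp`.
Pure real analysis.  References: Salmhofer 1999 §4.5.3 [cite: Salmhofer1999]; FST II CPAM 51 (1998) §3 [cite: FeldmanSalmhoferTrubowitz1998].
-/

noncomputable section

namespace Summit.HubbardSuperconductivity.HubbardSuperconductivity.Theorems.C4a

set_option linter.dupNamespace false -- summit = problem name (single-conjunct summit), D-0017

open Real Set MeasureTheory intervalIntegral

variable {g X K : ℝ → ℝ}

/-! ## §1 The window estimate with an integrable majorant of the remainder -/

/-- Part 1's window estimate with the END VALUES kept and the IBP remainder bounded by an arbitrary integrable majorant `ρ`: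
`|((X′g′ − Xg″)/g′²)K(g)| ≤ ρ` on `[a,b]` ⟹ `|∫_{a..b} X·K′(g)| ≤ (|X a|·|K(g a)| + |X b|·|K(g b)|)/σ + ∫_{a..b} ρ`. -/
theorem abs_intervalIntegral_mul_deriv_comp_le_ends_majorant {a b : ℝ} (hab : a ≤ b) (hg : ContDiff ℝ 2 g) (hX : ContDiff ℝ 1 X) (hK : ContDiff ℝ 1 K)
    {σ : ℝ} (hσ : 0 < σ) (hgσ : ∀ v ∈ Icc a b, σ ≤ |deriv g v|) {ρ : ℝ → ℝ} (hρi : IntervalIntegrable ρ volume a b)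
    (hρ : ∀ v ∈ Icc a b, |(deriv X v * deriv g v - X v * iteratedDeriv 2 g v) / deriv g v ^ 2 * K (g v)| ≤ ρ v) :
    |∫ v in a..b, X v * deriv K (g v)| ≤ (|X a| * |K (g a)| + |X b| * |K (g b)|) / σ + ∫ v in a..b, ρ v := by
  have hg' : ∀ s ∈ Icc a b, deriv g s ≠ 0 := fun s hs h0 => by
    have := hgσ s hs; rw [h0, abs_zero] at this; linarith
  have ha : a ∈ Icc a b := left_mem_Icc.2 hab
  have hb : b ∈ Icc a b := right_mem_Icc.2 hab
  rw [intervalIntegral_mul_deriv_comp_eq_boundary_sub hab hg hg' hX hK]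
  have hbd : ∀ v ∈ Icc a b, |X v / deriv g v * K (g v)| ≤ |X v| * |K (g v)| / σ := fun v hv => by
    rw [abs_mul, abs_div]
    have h1 : |X v| / |deriv g v| ≤ |X v| / σ := div_le_div_of_nonneg_left (abs_nonneg _) hσ (hgσ v hv)
    calc |X v| / |deriv g v| * |K (g v)| ≤ |X v| / σ * |K (g v)| := mul_le_mul_of_nonneg_right h1 (abs_nonneg _)
      _ = |X v| * |K (g v)| / σ := by ring
  have hint : |∫ v in a..b, (deriv X v * deriv g v - X v * iteratedDeriv 2 g v) / deriv g v ^ 2 * K (g v)| ≤ ∫ v in a..b, ρ v := by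
    refine (intervalIntegral.abs_integral_le_integral_abs hab).trans (intervalIntegral.integral_mono_on hab ?_ hρi fun v hv => hρ v hv)
    have hgc : Continuous (deriv g) := hg.continuous_deriv (by norm_num)
    have hu'c : ContinuousOn (fun x => (deriv X x * deriv g x - X x * iteratedDeriv 2 g x) / deriv g x ^ 2 * K (g x)) (uIcc a b) := by
      refine (ContinuousOn.div ?_ ?_ fun x hx => pow_ne_zero 2 (hg' x ((uIcc_of_le hab) ▸ hx))).mul
        (hK.continuous.comp hg.continuous).continuousOn
      · exact (((hX.continuous_deriv le_rfl).mul hgc).sub (hX.continuous.mul (hg.continuous_iteratedDeriv 2 le_rfl))).continuousOn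
      · exact (hgc.pow 2).continuousOn
    exact hu'c.intervalIntegrable.abs
  have h1 := hbd a ha
  have h2 := hbd b hb
  calc |X b / deriv g b * K (g b) - X a / deriv g a * K (g a) -
          ∫ v in a..b, (deriv X v * deriv g v - X v * iteratedDeriv 2 g v) / deriv g v ^ 2 * K (g v)|
      ≤ |X b / deriv g b * K (g b)| + |X a / deriv g a * K (g a)| +
          |∫ v in a..b, (deriv X v * deriv g v - X v * iteratedDeriv 2 g v) / deriv g v ^ 2 * K (g v)| :=
        (abs_sub _ _).trans (add_le_add (abs_sub _ _) le_rfl)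
    _ ≤ |X b| * |K (g b)| / σ + |X a| * |K (g a)| / σ + ∫ v in a..b, ρ v := add_le_add (add_le_add h2 h1) hint
    _ = (|X a| * |K (g a)| + |X b| * |K (g b)|) / σ + ∫ v in a..b, ρ v := by ring

/-! ## §2 The far-piece majorant and its integral -/

omit g X K in
/-- `∫_a^b (X₁/(c₂x) + X₀L₂/(c₂²x²))/M dx = (X₁/(c₂M))·log(b/a) + (X₀L₂/(c₂²M))·(a⁻¹ − b⁻¹)` for `0 < a ≤ b`. -/
theorem far_majorant_integral {a b c₂ M X₀ X₁ L₂ : ℝ} (ha : 0 < a) (hab : a ≤ b) (hc₂ : c₂ ≠ 0) (hM : M ≠ 0) :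
    ∫ x in a..b, (X₁ / (c₂ * x) + X₀ * L₂ / (c₂ ^ 2 * x ^ 2)) / M =
      X₁ / (c₂ * M) * Real.log (b / a) + X₀ * L₂ / (c₂ ^ 2 * M) * (a⁻¹ - b⁻¹) := by
  have hb : 0 < b := ha.trans_le hab
  have h0 : (0 : ℝ) ∉ uIcc a b := by
    rw [uIcc_of_le hab]; exact fun h => absurd h.1 (not_le.2 ha)
  have hfun : (fun x : ℝ => (X₁ / (c₂ * x) + X₀ * L₂ / (c₂ ^ 2 * x ^ 2)) / M) =
      fun x => X₁ / (c₂ * M) * x⁻¹ + X₀ * L₂ / (c₂ ^ 2 * M) * x ^ (-2 : ℤ) := by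
    funext x
    rw [zpow_neg, zpow_ofNat]
    field_simp
  have hi1 : IntervalIntegrable (fun x : ℝ => x⁻¹) volume a b := intervalIntegral.intervalIntegrable_inv (fun x hx => by
    rw [uIcc_of_le hab] at hx; exact (ha.trans_le hx.1).ne') continuousOn_id
  have hi2 : IntervalIntegrable (fun x : ℝ => x ^ (-2 : ℤ)) volume a b := by
    refine (continuousOn_id.zpow₀ (-2) fun x hx => Or.inl ?_).intervalIntegrable
    rw [uIcc_of_le hab] at hx; exact (ha.trans_le hx.1).ne'
  rw [hfun, intervalIntegral.integral_add (hi1.const_mul _) (hi2.const_mul _), intervalIntegral.integral_const_mul, intervalIntegral.integral_const_mul,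
    integral_inv_of_pos ha hb, integral_zpow (Or.inr ⟨by norm_num, h0⟩), show (-2 : ℤ) + 1 = -1 by norm_num, zpow_neg_one, zpow_neg_one]
  push_cast
  ring

/-! ## §3 Fold geometry: the band height above the fold value -/

/-- **Quadratic growth away from the fold point**: `g ∈ C²`, `g′(v*) = 0`, `c₂ ≤ g″` on `[α,β] ∋ v*` ⟹ `(c₂/2)(v − v*)² ≤ g v − g v*` on `[α,β]`. -/
theorem sub_ge_of_fold {α β vs c₂ : ℝ} (hg : ContDiff ℝ 2 g) (hvs : vs ∈ Icc α β) (hcrit : deriv g vs = 0)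
    (hc₂ : ∀ v ∈ Icc α β, c₂ ≤ iteratedDeriv 2 g v) {v : ℝ} (hv : v ∈ Icc α β) : c₂ / 2 * (v - vs) ^ 2 ≤ g v - g vs := by
  have hgd : Differentiable ℝ g := hg.differentiable two_ne_zero
  have hdg : Differentiable ℝ (deriv g) := by
    have h : Differentiable ℝ (iteratedDeriv 1 g) := ContDiff.differentiable_iteratedDeriv 1 hg (by norm_num)
    rwa [iteratedDeriv_one] at h
  have hd2 : ∀ x, deriv (deriv g) x = iteratedDeriv 2 g x := fun x => by
    rw [show iteratedDeriv 2 g = deriv (iteratedDeriv 1 g) from iteratedDeriv_succ, iteratedDeriv_one]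
  -- `h(s) = g s − (c₂/2)(s − v*)²` has `h′(s) = g′(s) − c₂(s − v*)`, which is `≥ 0` right of `v*` and `≤ 0` left of it
  set h : ℝ → ℝ := fun s => g s - c₂ / 2 * (s - vs) ^ 2 with hh
  have hhd : ∀ s, HasDerivAt h (deriv g s - c₂ * (s - vs)) s := fun s => by
    have h1' := (hasDerivAt_pow 2 (s - vs)).comp s ((hasDerivAt_id s).sub_const vs)
    have h1 : HasDerivAt (fun s : ℝ => (s - vs) ^ 2) (2 * (s - vs)) s := by
      simpa [Function.comp_def] using h1'
    have h2 := ((hgd s).hasDerivAt).sub (h1.const_mul (c₂ / 2))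
    refine h2.congr_deriv ?_
    ring
  -- `g′(s) − c₂(s − v*)` has the sign of `s − v*`: from `g″ ≥ c₂` by the mean value theorem applied to `g′`
  have hslope : ∀ s ∈ Icc α β, vs ≤ s → c₂ * (s - vs) ≤ deriv g s := fun s hs hvss => by
    rcases eq_or_lt_of_le hvss with he | hlt
    · rw [← he, sub_self, mul_zero, hcrit]
    · have hmvt := (convex_Icc vs s).mul_sub_le_image_sub_of_le_deriv hdg.continuous.continuousOn (hdg.differentiableOn.mono interior_subset)
        (fun x hx => by
          rw [hd2]
          have hx' : x ∈ Icc vs s := interior_subset hx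
          exact hc₂ x ⟨hvs.1.trans hx'.1, hx'.2.trans hs.2⟩)
        vs (left_mem_Icc.2 hvss) s (right_mem_Icc.2 hvss) hvss
      rw [hcrit, sub_zero] at hmvt
      linarith
  have hslope' : ∀ s ∈ Icc α β, s ≤ vs → deriv g s ≤ c₂ * (s - vs) := fun s hs hsvs => by
    rcases eq_or_lt_of_le hsvs with he | hlt
    · rw [he, sub_self, mul_zero, hcrit]
    · have hmvt := (convex_Icc s vs).mul_sub_le_image_sub_of_le_deriv hdg.continuous.continuousOn (hdg.differentiableOn.mono interior_subset)
        (fun x hx => by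
          rw [hd2]
          have hx' : x ∈ Icc s vs := interior_subset hx
          exact hc₂ x ⟨hs.1.trans hx'.1, hx'.2.trans hvs.2⟩)
        s (left_mem_Icc.2 hsvs) vs (right_mem_Icc.2 hsvs) hsvs
      rw [hcrit] at hmvt
      linarith
  have hcont : Continuous h := hgd.continuous.sub (by continuity)
  have hhvs : h vs = g vs := by simp [hh]
  rcases le_total vs v with hle | hle
  · -- `h` is monotone on `[v*, v]`
    have hmono := monotoneOn_of_deriv_nonneg (convex_Icc vs v) hcont.continuousOn
      (fun x _ => (hhd x).differentiableAt.differentiableWithinAt) fun x hx => by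
        have hx' : x ∈ Icc vs v := interior_subset hx
        rw [(hhd x).deriv]
        have := hslope x ⟨hvs.1.trans hx'.1, hx'.2.trans hv.2⟩ hx'.1
        linarith
    have := hmono (left_mem_Icc.2 hle) (right_mem_Icc.2 hle) hle
    rw [hhvs] at this
    simp only [hh] at this
    linarith
  · have hanti := antitoneOn_of_deriv_nonpos (convex_Icc v vs) hcont.continuousOn
      (fun x _ => (hhd x).differentiableAt.differentiableWithinAt) fun x hx => by
        have hx' : x ∈ Icc v vs := interior_subset hx
        rw [(hhd x).deriv]
        have := hslope' x ⟨hv.1.trans hx'.1, hx'.2.trans hvs.2⟩ hx'.2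
        linarith
    have := hanti (left_mem_Icc.2 hle) (right_mem_Icc.2 hle) hle
    rw [hhvs] at this
    simp only [hh] at this
    linarith

end Summit.HubbardSuperconductivity.HubbardSuperconductivity.Theorems.C4a

end
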